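/-
Copyright (c) 2026 the pub-hodgecm-mathlib formalisation cell (harness21).  Prover seat hodgecm-mathlib-K2E4-p14 (g5), Track B ∕ K2-LIT, h413 =
`stmt-HodgeConjecture-24833`, line `K2_E1_TraceFormulaBeta`, campaign «EIS-RANK-ONE» rung R6f(ii); DEAL «EIS-R6-CM» of the dealer K2E1-plan (g3) 2026-09-04T05:26:42Z ∕ 05:37:17Z
(«`hadj`∕`hCT′`∕`hM′ψ` → ED. 2»): the ADJOINT input discharged by ★ p857605, the intertwining operators made CONCRETE.
-/
import Summits.HodgeConjecture.HodgeConjecture.Theorems.K2E1MaassSelbergCMThree        -- ★ p857669∕p857683 (this seat): the flat-section relation, `hAVG` discharged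
import Summits.HodgeConjecture.HodgeConjecture.Theorems.K2E1IntertwiningAdjoint        -- ★ p857605 (K2E1-p09): `⟨M_w h, f′⟩_β = ⟨h, M_{w⁻¹} f′⟩_β` on `U(J₃)`
import Summits.HodgeConjecture.HodgeConjecture.Theorems.K2E1BorelWeightAverage          -- ★ p857644 (K2E4-p11): «AVG»
import HarnessLib

/-!
# K2·E1 — `K2E1MaassSelbergCMThreeAdjoint`: THE FLAT-SECTION MAASS–SELBERG RELATION OF `U(J₃)` WITH CONCRETE INTERTWINING OPERATORS, `hadj` DISCHARGED
# (campaign «EIS-RANK-ONE», rung R6f(ii): ED. 3 of the (C2) chain — `M h (g) = ∫_{N(𝔸)} h(w₀ u g) du`, `M′` with `w₀⁻¹`, the adjointness from ★ p857605 by complex conjugation)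

Track B ∕ K2-LIT, crux h413 = `stmt-HodgeConjecture-24833`, route of record `HCCMUnconditional`; cell `hodgecm-mathlib`, squad K2, ENGINE E1.  Prover seat
`hodgecm-mathlib-K2E4-p14` (g5).  THEOREMS ONLY (no `def`, no `instance`, no notation, no named-fact hypothesis, no `sorry`); lane `--supports stmt-HodgeConjecture-24833 --as helper`
(count-neutral).  Closes no socket.

THE MATHEMATICS [MoeglinWaldspurger1995, II.1.8, IV.2.1–IV.2.3; Arthur1980TraceFormulaII, §4; Garrett2018, §1.10, §11.3].  ★ `maassSelberg_flatSectionU_three_avg` took the intertwining operators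
`M, M′` ABSTRACTLY with the adjointness `hadj : [ψ, M χ]_β = [M′ψ, χ]_β`.  Here they are the CONCRETE left intertwining integrals `(M h)(g) = ∫_{N(𝔸)} h(w₀·u·g) dν(u)`,
`(M′ h)(g) = ∫_{N(𝔸)} h(w₀⁻¹·u·g) dν(u)` (`w₀ = ι(J₃) =` ★ `weylLongU`), and `hadj` is DISCHARGED from ★ p857605 `integral_wt_smul_intertwining_mul_conj_eq_three` (`⟨M h, F⟩_β = ⟨h, M′F⟩_β`
with `h := χ = 𝟙_{T<H}(f′ + Mf′)`, `F := ψ`) by complex conjugation of both sides (`integral_conj`), under its two honest absolute-convergence inputs `habs`, `habs′`.  The remaining named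
inputs are `hCT` (★ R3 under Godement `hfin`), `hCT′`∕`hM′ψ` NOW AGAINST THE CONCRETE `M, M′` (★ R3 two-piece constant term + ★ R6a∕R6c height bounds `H(w₀ u g)·H(g) ≤ 1`), `hi₅`, `hψL1`,
`Λ′` bounded (★ R6e ∘ [D2]), `hΞᵢ` (★ p857588), coefficient facts, `hsum` (★ R2 CM via `summable_flatSectionU_cm_three`).
HONEST LABEL: HC_CM is proved only modulo the 7 printed citations (2 remaining named inputs: hLiu418 = `stmt-HodgeConjecture-24832`, h413 = `stmt-HodgeConjecture-24833`) until rung 0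
closes; this file asserts no named fact and closes no socket.
-/

set_option autoImplicit false
-- the mandated namespace repeats the single-problem summit's segment (`HodgeConjecture.HodgeConjecture`)
set_option linter.dupNamespace false

noncomputable section

open MeasureTheory Measure NumberField IsDedekindDomain Set MulAction
open scoped ENNReal NNReal ComplexConjugate
open Literature.MeasureTheory.Group Literature.NumberTheory
open Literature.NumberTheory.Automorphic Literature.NumberTheory.Automorphic.UnitaryGroup AdelicGroupData
open Summit.HodgeConjecture.HodgeConjecture.Cruxes.H413.K2E1BorelEisensteinU
open Summit.HodgeConjecture.HodgeConjecture.Cruxes.H413.K2E1IdeleClassMellinWeighted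
open Summit.HodgeConjecture.HodgeConjecture.Cruxes.H413.K2E1TorusHeightMellin
open Summit.HodgeConjecture.HodgeConjecture.Cruxes.H413.K2E1MaassSelbergBracketsThree
open Summit.HodgeConjecture.HodgeConjecture.Cruxes.H413.K2E1MaassSelbergCMThree
open Summit.HodgeConjecture.HodgeConjecture.Cruxes.H413.K2E1TruncatedEisensteinExplicit (forall_arithmeticBorel_indicator)
open Summit.HodgeConjecture.HodgeConjecture.Cruxes.H413.K2E1IntertwiningAdjoint

namespace Summit.HodgeConjecture.HodgeConjecture.Cruxes.H413.K2E1MaassSelbergCMThreeAdjoint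

variable {F E : Type} [Field F] [NumberField F] [Field E] [NumberField E] [Algebra F E] {c : E ≃ₐ[F] E}
variable [MeasurableSpace (quasiSplit F E c 3).Adelic] [BorelSpace (quasiSplit F E c 3).Adelic]
variable [MeasurableSpace (AdeleRing (𝓞 E) E)ˣ] [BorelSpace (AdeleRing (𝓞 E) E)ˣ]

omit [BorelSpace (quasiSplit F E c 3).Adelic] [MeasurableSpace (AdeleRing (𝓞 E) E)ˣ] [BorelSpace (AdeleRing (𝓞 E) E)ˣ] in
/-- Complex conjugation swaps the slots of a weighted bracket integrand: `conj ((β g)·(A·conj B)) = (β g)·(B·conj A)`. [folklore] -/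
theorem conj_weight_smul_mul_conj (r : ℝ) (A B : ℂ) : conj (r • (A * conj B)) = r • (B * conj A) := by
  rw [Complex.real_smul, Complex.real_smul, map_mul, map_mul, Complex.conj_ofReal, Complex.conj_conj]; ring

/-- **THE MAASS–SELBERG RELATION FOR FLAT SECTIONS OF `U(J₃)` — CONCRETE INTERTWINING OPERATORS, `hadj` AND `hAVG` DISCHARGED.**  As ★ `maassSelberg_flatSectionU_three_avg`, with
`M h (g) := ∫_{N(𝔸)} h(w₀·u·g) dν`, `M′ h (g) := ∫_{N(𝔸)} h(w₀⁻¹·u·g) dν` spelled out and the adjointness supplied by ★ p857605 under its absolute-convergence inputs `habs`, `habs′`.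
[cite: MoeglinWaldspurger1995, II.1.8 and IV.2.1–IV.2.3] [cite: Arthur1980TraceFormulaII, §4] [cite: Garrett2018, §1.10 and §11.3] -/
theorem maassSelberg_flatSectionU_three_adj (h2 : Module.finrank F E = 2) (hc : c * c = 1) (hc1 : c ≠ 1)
    (μ : Measure (quasiSplit F E c 3).automorphicQuotient) [(quasiSplit F E c 3).IsAutomorphicMeasure μ]
    (νG : Measure (quasiSplit F E c 3).Adelic) [νG.IsHaarMeasure] [νG.IsInvInvariant]
    (μK : Measure ((standardMaximalCompactGL 3 E).comap (adelicVal F E c 3 ((StdForm.antidiagonal 3).over E)) : Subgroup (quasiSplit F E c 3).Adelic))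
    [μK.IsHaarMeasure]
    (νI : Measure (AdeleRing (𝓞 E) E)ˣ) [νI.IsHaarMeasure]
    (hBK : ∀ g : (quasiSplit F E c 3).Adelic, ∃ b ∈ borelAdelic F E c 3, ∃ k : (quasiSplit F E c 3).Adelic,
      adelicVal F E c 3 ((StdForm.antidiagonal 3).over E) k ∈ standardMaximalCompactGL 3 E ∧ g = b * k)
    {𝓕I : Set (AdeleRing (𝓞 E) E)ˣ} (h𝓕I : IsIdeleClassDomain E 𝓕I)
    (ν : Measure ↥(adelicUnipotent F E c 3)) [ν.IsHaarMeasure] [ν.IsInvInvariant]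
    {𝓕 : Set ↥(adelicUnipotent F E c 3)} (h𝓕N : IsFundamentalDomain ↥(rationalUnipotent F E c 3) 𝓕 ν) (h𝓕₀ : ν 𝓕 ≠ 0) (h𝓕top : ν 𝓕 ≠ ∞) :
    ∃ cμ K : ℝ, 0 < cμ ∧ 0 < K ∧
      ∀ {β : (quasiSplit F E c 3).Adelic → ℝ≥0∞}, IsCoveringWeight ((arithmeticBorel F E c 3).map (quasiSplit F E c 3).arithmeticSubgroup.subtype) β →
      ∀ {T : ℝ≥0}, 1 ≤ T →
      ∀ {φ φ' φt φt' : (quasiSplit F E c 3).Adelic → ℂ},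
      Measurable φ →
        (∀ (n : unipotentInBorel F E c 3) (y : (quasiSplit F E c 3).Adelic), φ (((n : borelAdelic F E c 3) : (quasiSplit F E c 3).Adelic) * y) = φ y) →
        (∀ b ∈ arithmeticBorel F E c 3, ∀ y : (quasiSplit F E c 3).Adelic, φ ((b : (quasiSplit F E c 3).Adelic) * y) = φ y) →
      ∀ {Cφ : ℝ}, (∀ x, ‖φ x‖ ≤ Cφ) →
      Measurable φ' →
        (∀ (n : unipotentInBorel F E c 3) (y : (quasiSplit F E c 3).Adelic), φ' (((n : borelAdelic F E c 3) : (quasiSplit F E c 3).Adelic) * y) = φ' y) →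
        (∀ b ∈ arithmeticBorel F E c 3, ∀ y : (quasiSplit F E c 3).Adelic, φ' ((b : (quasiSplit F E c 3).Adelic) * y) = φ' y) →
      ∀ {Cφ' : ℝ}, (∀ x, ‖φ' x‖ ≤ Cφ') →
      Measurable φt →
        (∀ (n : unipotentInBorel F E c 3) (y : (quasiSplit F E c 3).Adelic), φt (((n : borelAdelic F E c 3) : (quasiSplit F E c 3).Adelic) * y) = φt y) →
        (∀ b ∈ arithmeticBorel F E c 3, ∀ y : (quasiSplit F E c 3).Adelic, φt ((b : (quasiSplit F E c 3).Adelic) * y) = φt y) →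
      ∀ {Cφt : ℝ}, (∀ x, ‖φt x‖ ≤ Cφt) →
      Measurable φt' →
        (∀ (n : unipotentInBorel F E c 3) (y : (quasiSplit F E c 3).Adelic), φt' (((n : borelAdelic F E c 3) : (quasiSplit F E c 3).Adelic) * y) = φt' y) →
        (∀ b ∈ arithmeticBorel F E c 3, ∀ y : (quasiSplit F E c 3).Adelic, φt' ((b : (quasiSplit F E c 3).Adelic) * y) = φt' y) →
      ∀ {Cφt' : ℝ}, (∀ x, ‖φt' x‖ ≤ Cφt') →
      ∀ {z z' : ℂ}, 2 < z'.re → z'.re < z.re →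
        (∀ x : (quasiSplit F E c 3).Adelic, T < borelHeight x → borelConstantTerm ν 𝓕 (eisensteinSeriesU (flatSectionU φ z)) x = flatSectionU φ z x + flatSectionU φt (2 - z) x) →
        (∀ g : (quasiSplit F E c 3).Adelic,
          Summable fun q : Quotient (orbitRel ↥(borelU (c : E →+* E) ((StdForm.antidiagonal 3).over E)) ↥(unitaryGroupOfForm (c : E →+* E) ((StdForm.antidiagonal 3).over E))) =>
            flatSectionU φ z ((quasiSplit F E c 3).toAdelic (q.out : ↥(unitaryGroupOfForm (c : E →+* E) ((StdForm.antidiagonal 3).over E))) * g)) →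
      ∀ {Λ' : (quasiSplit F E c 3).Adelic → ℂ},
        Measurable Λ' → (∀ (γ : (quasiSplit F E c 3).arithmeticSubgroup) (x : (quasiSplit F E c 3).Adelic), Λ' ((γ : (quasiSplit F E c 3).Adelic) * x) = Λ' x) →
        ∀ {M₁ : ℝ}, (∀ g, ‖Λ' g‖ ≤ M₁) →
        ∫⁻ g, β g * ‖({y : (quasiSplit F E c 3).Adelic | borelHeight y ≤ T}.indicator (flatSectionU φ z) g - {y : (quasiSplit F E c 3).Adelic | T < borelHeight y}.indicator (flatSectionU φt (2 - z)) g)‖ₑ ∂νG < ∞ →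
      -- two-piece constant term of `Λ′` and the `R6a` evaluation, against the CONCRETE operators
        (∀ g, borelConstantTerm ν 𝓕 Λ' g = {y : (quasiSplit F E c 3).Adelic | borelHeight y ≤ T}.indicator (flatSectionU φ' z' + flatSectionU φt' (2 - z')) g - (∫ u : ↥(adelicUnipotent F E c 3), {y : (quasiSplit F E c 3).Adelic | T < borelHeight y}.indicator (flatSectionU φ' z' + flatSectionU φt' (2 - z')) ((quasiSplit F E c 3).toAdelic (weylLongU (c : E →+* E) (rfl : (StdForm.antidiagonal 3).over E = (StdForm.antidiagonal 3).over E)) * ((u : (quasiSplit F E c 3).Adelic) * g)) ∂ν)) →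
        (∀ g, T < borelHeight g → (∫ u : ↥(adelicUnipotent F E c 3), ({y : (quasiSplit F E c 3).Adelic | borelHeight y ≤ T}.indicator (flatSectionU φ z) (((quasiSplit F E c 3).toAdelic (weylLongU (c : E →+* E) (rfl : (StdForm.antidiagonal 3).over E = (StdForm.antidiagonal 3).over E)))⁻¹ * ((u : (quasiSplit F E c 3).Adelic) * g)) - {y : (quasiSplit F E c 3).Adelic | T < borelHeight y}.indicator (flatSectionU φt (2 - z)) (((quasiSplit F E c 3).toAdelic (weylLongU (c : E →+* E) (rfl : (StdForm.antidiagonal 3).over E = (StdForm.antidiagonal 3).over E)))⁻¹ * ((u : (quasiSplit F E c 3).Adelic) * g))) ∂ν) = flatSectionU φt (2 - z) g) →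
        Integrable (fun g => (β g).toReal • (({y : (quasiSplit F E c 3).Adelic | borelHeight y ≤ T}.indicator (flatSectionU φ z) g - {y : (quasiSplit F E c 3).Adelic | T < borelHeight y}.indicator (flatSectionU φt (2 - z)) g) * conj (∫ u : ↥(adelicUnipotent F E c 3), {y : (quasiSplit F E c 3).Adelic | T < borelHeight y}.indicator (flatSectionU φ' z' + flatSectionU φt' (2 - z')) ((quasiSplit F E c 3).toAdelic (weylLongU (c : E →+* E) (rfl : (StdForm.antidiagonal 3).over E = (StdForm.antidiagonal 3).over E)) * ((u : (quasiSplit F E c 3).Adelic) * g)) ∂ν))) νG →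
      -- ★ p857605's absolute convergence (`h := χ`, `F := ψ`)
        ∫⁻ g, β g * ∫⁻ u : ↥(adelicUnipotent F E c 3), ‖{y : (quasiSplit F E c 3).Adelic | T < borelHeight y}.indicator (flatSectionU φ' z' + flatSectionU φt' (2 - z')) ((quasiSplit F E c 3).toAdelic (weylLongU (c : E →+* E) (rfl : (StdForm.antidiagonal 3).over E = (StdForm.antidiagonal 3).over E)) * ((u : (quasiSplit F E c 3).Adelic) * g)) * conj ({y : (quasiSplit F E c 3).Adelic | borelHeight y ≤ T}.indicator (flatSectionU φ z) g - {y : (quasiSplit F E c 3).Adelic | T < borelHeight y}.indicator (flatSectionU φt (2 - z)) g)‖ₑ ∂ν ∂νG < ∞ →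
        ∫⁻ g, β g * ∫⁻ u : ↥(adelicUnipotent F E c 3), ‖{y : (quasiSplit F E c 3).Adelic | T < borelHeight y}.indicator (flatSectionU φ' z' + flatSectionU φt' (2 - z')) g * conj ({y : (quasiSplit F E c 3).Adelic | borelHeight y ≤ T}.indicator (flatSectionU φ z) (((quasiSplit F E c 3).toAdelic (weylLongU (c : E →+* E) (rfl : (StdForm.antidiagonal 3).over E = (StdForm.antidiagonal 3).over E)))⁻¹ * ((u : (quasiSplit F E c 3).Adelic) * g)) - {y : (quasiSplit F E c 3).Adelic | T < borelHeight y}.indicator (flatSectionU φt (2 - z)) (((quasiSplit F E c 3).toAdelic (weylLongU (c : E →+* E) (rfl : (StdForm.antidiagonal 3).over E = (StdForm.antidiagonal 3).over E)))⁻¹ * ((u : (quasiSplit F E c 3).Adelic) * g)))‖ₑ ∂ν ∂νG < ∞ →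
      ∀ {Ξ₁ Ξ₂ Ξ₃ Ξ₄ : (AdeleRing (𝓞 E) E)ˣ → ℂ},
      Measurable Ξ₁ → ∀ {CΞ₁ : ℝ}, (∀ x, ‖Ξ₁ x‖ ≤ CΞ₁) → (∀ k ∈ GaloisRepresentations.principalIdeles E, ∀ x, Ξ₁ (k * x) = Ξ₁ x) →
        (∀ (r : ℝ≥0ˣ) (x : (AdeleRing (𝓞 E) E)ˣ), Ξ₁ (posRealIdele E r * x) = Ξ₁ x) →
        (∀ t : torusInBorel F E c 3,
          ∫ k, φ (((t : borelAdelic F E c 3) : (quasiSplit F E c 3).Adelic) * (k : (quasiSplit F E c 3).Adelic)) *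
              conj (φ' (((t : borelAdelic F E c 3) : (quasiSplit F E c 3).Adelic) * (k : (quasiSplit F E c 3).Adelic))) ∂μK = Ξ₁ (diagUnit (t : borelAdelic F E c 3).2 0)) →
      Measurable Ξ₂ → ∀ {CΞ₂ : ℝ}, (∀ x, ‖Ξ₂ x‖ ≤ CΞ₂) → (∀ k ∈ GaloisRepresentations.principalIdeles E, ∀ x, Ξ₂ (k * x) = Ξ₂ x) →
        (∀ (r : ℝ≥0ˣ) (x : (AdeleRing (𝓞 E) E)ˣ), Ξ₂ (posRealIdele E r * x) = Ξ₂ x) →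
        (∀ t : torusInBorel F E c 3,
          ∫ k, φ (((t : borelAdelic F E c 3) : (quasiSplit F E c 3).Adelic) * (k : (quasiSplit F E c 3).Adelic)) *
              conj (φt' (((t : borelAdelic F E c 3) : (quasiSplit F E c 3).Adelic) * (k : (quasiSplit F E c 3).Adelic))) ∂μK = Ξ₂ (diagUnit (t : borelAdelic F E c 3).2 0)) →
      Measurable Ξ₃ → ∀ {CΞ₃ : ℝ}, (∀ x, ‖Ξ₃ x‖ ≤ CΞ₃) → (∀ k ∈ GaloisRepresentations.principalIdeles E, ∀ x, Ξ₃ (k * x) = Ξ₃ x) →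
        (∀ (r : ℝ≥0ˣ) (x : (AdeleRing (𝓞 E) E)ˣ), Ξ₃ (posRealIdele E r * x) = Ξ₃ x) →
        (∀ t : torusInBorel F E c 3,
          ∫ k, φt (((t : borelAdelic F E c 3) : (quasiSplit F E c 3).Adelic) * (k : (quasiSplit F E c 3).Adelic)) *
              conj (φ' (((t : borelAdelic F E c 3) : (quasiSplit F E c 3).Adelic) * (k : (quasiSplit F E c 3).Adelic))) ∂μK = Ξ₃ (diagUnit (t : borelAdelic F E c 3).2 0)) →
      Measurable Ξ₄ → ∀ {CΞ₄ : ℝ}, (∀ x, ‖Ξ₄ x‖ ≤ CΞ₄) → (∀ k ∈ GaloisRepresentations.principalIdeles E, ∀ x, Ξ₄ (k * x) = Ξ₄ x) →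
        (∀ (r : ℝ≥0ˣ) (x : (AdeleRing (𝓞 E) E)ˣ), Ξ₄ (posRealIdele E r * x) = Ξ₄ x) →
        (∀ t : torusInBorel F E c 3,
          ∫ k, φt (((t : borelAdelic F E c 3) : (quasiSplit F E c 3).Adelic) * (k : (quasiSplit F E c 3).Adelic)) *
              conj (φt' (((t : borelAdelic F E c 3) : (quasiSplit F E c 3).Adelic) * (k : (quasiSplit F E c 3).Adelic))) ∂μK = Ξ₄ (diagUnit (t : borelAdelic F E c 3).2 0)) →
        ∫ x, (quasiSplit F E c 3).quotFun (truncation ν 𝓕 T (eisensteinSeriesU (flatSectionU φ z))) x * conj ((quasiSplit F E c 3).quotFun Λ' x) ∂μ =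
          (cμ : ℂ) * ((K : ℂ) *
            ((((T : ℝ) : ℂ) ^ (z + conj z' - 2) / (z + conj z' - 2)) * (∫ x in {x : (AdeleRing (𝓞 E) E)ˣ | (IdeleClassGroup.ideleNorm E x : ℝ) ≤ 1} ∩ 𝓕I, ((IdeleClassGroup.ideleNorm E x : ℝ) : ℂ) * Ξ₁ x ∂νI)
              + (((T : ℝ) : ℂ) ^ (z - conj z') / (z - conj z')) * (∫ x in {x : (AdeleRing (𝓞 E) E)ˣ | (IdeleClassGroup.ideleNorm E x : ℝ) ≤ 1} ∩ 𝓕I, ((IdeleClassGroup.ideleNorm E x : ℝ) : ℂ) * Ξ₂ x ∂νI)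
              - (((T : ℝ) : ℂ) ^ (-(z - conj z')) / (z - conj z')) * (∫ x in {x : (AdeleRing (𝓞 E) E)ˣ | (IdeleClassGroup.ideleNorm E x : ℝ) ≤ 1} ∩ 𝓕I, ((IdeleClassGroup.ideleNorm E x : ℝ) : ℂ) * Ξ₃ x ∂νI)
              - (((T : ℝ) : ℂ) ^ (-(z + conj z' - 2)) / (z + conj z' - 2)) * (∫ x in {x : (AdeleRing (𝓞 E) E)ˣ | (IdeleClassGroup.ideleNorm E x : ℝ) ≤ 1} ∩ 𝓕I, ((IdeleClassGroup.ideleNorm E x : ℝ) : ℂ) * Ξ₄ x ∂νI))) := by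
  obtain ⟨cμ, K, hcμ, hK, hGen⟩ := maassSelberg_flatSectionU_three h2 hc hc1 μ νG μK νI hBK h𝓕I
  refine ⟨cμ, K, hcμ, hK, ?_⟩
  intro β hβ T hT φ φ' φt φt' hφm hφN hφB Cφ hφC hφ'm hφ'N hφ'B Cφ' hφ'C hφtm hφtN hφtB Cφt hφtC hφt'm hφt'N hφt'B Cφt' hφt'C
    z z' hz' hzz' hCT hsum Λ' hΛm hΛG M₁ hΛbdd hψL1 hCT' hM'ψ hi₅ habs habs'
    Ξ₁ Ξ₂ Ξ₃ Ξ₄ hΞ₁m CΞ₁ hΞ₁C hΞ₁K hΞ₁M hΞ₁ hΞ₂m CΞ₂ hΞ₂C hΞ₂K hΞ₂M hΞ₂ hΞ₃m CΞ₃ hΞ₃C hΞ₃K hΞ₃M hΞ₃ hΞ₄m CΞ₄ hΞ₄C hΞ₄K hΞ₄M hΞ₄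
  -- Borel-ness and invariances of `ψ` and `χ` (as in ★ ED. 2)
  have hSle : MeasurableSet {y : (quasiSplit F E c 3).Adelic | borelHeight y ≤ T} := (isClosed_setOf_borelHeight_le T).measurableSet
  have hSgt : MeasurableSet {y : (quasiSplit F E c 3).Adelic | T < borelHeight y} := measurableSet_lt measurable_const measurable_borelHeight
  have hψm : Measurable (fun x => ({y : (quasiSplit F E c 3).Adelic | borelHeight y ≤ T}.indicator (flatSectionU φ z) x - {y : (quasiSplit F E c 3).Adelic | T < borelHeight y}.indicator (flatSectionU φt (2 - z)) x)) :=
    ((measurable_flatSectionU hφm z).indicator hSle).sub ((measurable_flatSectionU hφtm (2 - z)).indicator hSgt)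
  have hχm : Measurable (fun x => {y : (quasiSplit F E c 3).Adelic | T < borelHeight y}.indicator (flatSectionU φ' z' + flatSectionU φt' (2 - z')) x) := ((measurable_flatSectionU hφ'm z').add (measurable_flatSectionU hφt'm (2 - z'))).indicator hSgt
  have hcoefN : ∀ {α : (quasiSplit F E c 3).Adelic → ℂ}, (∀ (n : unipotentInBorel F E c 3) (y : (quasiSplit F E c 3).Adelic), α (((n : borelAdelic F E c 3) : (quasiSplit F E c 3).Adelic) * y) = α y) →
      ∀ (a : ℂ) (u : ↥(adelicUnipotent F E c 3)) (g : (quasiSplit F E c 3).Adelic), flatSectionU α a ((u : (quasiSplit F E c 3).Adelic) * g) = flatSectionU α a g ∧ borelHeight ((u : (quasiSplit F E c 3).Adelic) * g) = borelHeight g := by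
    intro α hαN a u g
    have hn : u.1 ∈ adelicUnipotent F E c 3 := u.2
    have hH : borelHeight ((u : (quasiSplit F E c 3).Adelic) * g) = borelHeight g := borelHeight_unipotent_mul hn g
    refine ⟨?_, hH⟩
    rw [flatSectionU_apply, flatSectionU_apply, hαN ⟨⟨(u : (quasiSplit F E c 3).Adelic), adelicUnipotent_le_borelAdelic hn⟩, (mem_unipotentInBorel_iff _).2 hn⟩ g, hH]
  have hψN : ∀ (u : ↥(adelicUnipotent F E c 3)) (g : (quasiSplit F E c 3).Adelic), (fun x => ({y : (quasiSplit F E c 3).Adelic | borelHeight y ≤ T}.indicator (flatSectionU φ z) x - {y : (quasiSplit F E c 3).Adelic | T < borelHeight y}.indicator (flatSectionU φt (2 - z)) x)) ((u : (quasiSplit F E c 3).Adelic) * g) = (fun x => ({y : (quasiSplit F E c 3).Adelic | borelHeight y ≤ T}.indicator (flatSectionU φ z) x - {y : (quasiSplit F E c 3).Adelic | T < borelHeight y}.indicator (flatSectionU φt (2 - z)) x)) g := by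
    intro u g
    dsimp only
    rw [(indicator_height_apply_eq (hcoefN hφN z u g).2 (hcoefN hφN z u g).1).1, (indicator_height_apply_eq (hcoefN hφtN (2 - z) u g).2 (hcoefN hφtN (2 - z) u g).1).2]
  have hχN : ∀ (u : ↥(adelicUnipotent F E c 3)) (g : (quasiSplit F E c 3).Adelic), (fun x => {y : (quasiSplit F E c 3).Adelic | T < borelHeight y}.indicator (flatSectionU φ' z' + flatSectionU φt' (2 - z')) x) ((u : (quasiSplit F E c 3).Adelic) * g) = (fun x => {y : (quasiSplit F E c 3).Adelic | T < borelHeight y}.indicator (flatSectionU φ' z' + flatSectionU φt' (2 - z')) x) g := by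
    intro u g
    dsimp only
    have hsum' : (flatSectionU φ' z' + flatSectionU φt' (2 - z')) ((u : (quasiSplit F E c 3).Adelic) * g) = (flatSectionU φ' z' + flatSectionU φt' (2 - z')) g := by
      rw [Pi.add_apply, Pi.add_apply, (hcoefN hφ'N z' u g).1, (hcoefN hφt'N (2 - z') u g).1]
    exact (indicator_height_apply_eq (hcoefN hφ'N z' u g).2 hsum').2
  have hfB : ∀ {α : (quasiSplit F E c 3).Adelic → ℂ}, (∀ b ∈ arithmeticBorel F E c 3, ∀ y : (quasiSplit F E c 3).Adelic, α ((b : (quasiSplit F E c 3).Adelic) * y) = α y) →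
      ∀ (a : ℂ), ∀ b ∈ arithmeticBorel F E c 3, ∀ x : (quasiSplit F E c 3).Adelic, flatSectionU α a ((b : (quasiSplit F E c 3).Adelic) * x) = flatSectionU α a x := by
    intro α hαB a b hb x
    rw [flatSectionU_apply, flatSectionU_apply, hαB b hb x, borelHeight_arithmeticBorel_mul hb]
  have hψB : ∀ b ∈ arithmeticBorel F E c 3, ∀ x : (quasiSplit F E c 3).Adelic, (fun x => ({y : (quasiSplit F E c 3).Adelic | borelHeight y ≤ T}.indicator (flatSectionU φ z) x - {y : (quasiSplit F E c 3).Adelic | T < borelHeight y}.indicator (flatSectionU φt (2 - z)) x)) ((b : (quasiSplit F E c 3).Adelic) * x) = (fun x => ({y : (quasiSplit F E c 3).Adelic | borelHeight y ≤ T}.indicator (flatSectionU φ z) x - {y : (quasiSplit F E c 3).Adelic | T < borelHeight y}.indicator (flatSectionU φt (2 - z)) x)) x := by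
    intro b hb x
    dsimp only
    rw [forall_arithmeticBorel_indicator (hfB hφB z) (fun h => h ≤ T) b hb x, forall_arithmeticBorel_indicator (hfB hφtB (2 - z)) (fun h => T < h) b hb x]
  have hsumB : ∀ b ∈ arithmeticBorel F E c 3, ∀ x : (quasiSplit F E c 3).Adelic, (flatSectionU φ' z' + flatSectionU φt' (2 - z')) ((b : (quasiSplit F E c 3).Adelic) * x) = (flatSectionU φ' z' + flatSectionU φt' (2 - z')) x := fun b hb x => by
    rw [Pi.add_apply, Pi.add_apply, hfB hφ'B z' b hb x, hfB hφt'B (2 - z') b hb x]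
  have hχB : ∀ b ∈ arithmeticBorel F E c 3, ∀ x : (quasiSplit F E c 3).Adelic, (fun x => {y : (quasiSplit F E c 3).Adelic | T < borelHeight y}.indicator (flatSectionU φ' z' + flatSectionU φt' (2 - z')) x) ((b : (quasiSplit F E c 3).Adelic) * x) = (fun x => {y : (quasiSplit F E c 3).Adelic | T < borelHeight y}.indicator (flatSectionU φ' z' + flatSectionU φt' (2 - z')) x) x := by
    intro b hb x
    dsimp only
    rw [forall_arithmeticBorel_indicator hsumB (fun h => T < h) b hb x]
  -- `hAVG` by ★ p857644 (as in ★ ED. 2 of `K2E1MaassSelbergCMThree`)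
  have hΛB : ∀ b ∈ arithmeticBorel F E c 3, ∀ x : (quasiSplit F E c 3).Adelic, Λ' ((b : (quasiSplit F E c 3).Adelic) * x) = Λ' x := fun b _ x => hΛG b x
  have hL1 : ∫⁻ g, β g * ‖({y : (quasiSplit F E c 3).Adelic | borelHeight y ≤ T}.indicator (flatSectionU φ z) g - {y : (quasiSplit F E c 3).Adelic | T < borelHeight y}.indicator (flatSectionU φt (2 - z)) g) * conj (Λ' g)‖ₑ ∂νG < ∞ := by
    have hM : ∀ g, ‖conj (Λ' g)‖ₑ ≤ ENNReal.ofReal M₁ := fun g => by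
      rw [← ofReal_norm, Complex.norm_conj]; exact ENNReal.ofReal_le_ofReal (hΛbdd g)
    calc ∫⁻ g, β g * ‖({y : (quasiSplit F E c 3).Adelic | borelHeight y ≤ T}.indicator (flatSectionU φ z) g - {y : (quasiSplit F E c 3).Adelic | T < borelHeight y}.indicator (flatSectionU φt (2 - z)) g) * conj (Λ' g)‖ₑ ∂νG
        ≤ ∫⁻ g, β g * ‖({y : (quasiSplit F E c 3).Adelic | borelHeight y ≤ T}.indicator (flatSectionU φ z) g - {y : (quasiSplit F E c 3).Adelic | T < borelHeight y}.indicator (flatSectionU φt (2 - z)) g)‖ₑ * ENNReal.ofReal M₁ ∂νG := lintegral_mono fun g => by rw [enorm_mul, ← mul_assoc]; gcongr; exact hM g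
      _ = (∫⁻ g, β g * ‖({y : (quasiSplit F E c 3).Adelic | borelHeight y ≤ T}.indicator (flatSectionU φ z) g - {y : (quasiSplit F E c 3).Adelic | T < borelHeight y}.indicator (flatSectionU φt (2 - z)) g)‖ₑ ∂νG) * ENNReal.ofReal M₁ := lintegral_mul_const' _ _ ENNReal.ofReal_ne_top
      _ < ∞ := ENNReal.mul_lt_top hψL1 ENNReal.ofReal_lt_top
  have hAVG := K2E1BorelWeightAverage.integral_wt_smul_mul_conj_eq_mul_conj_borelConstantTerm_three hc hc1 νG ν h𝓕N h𝓕₀ h𝓕top hβ hψm hΛm hψN hψB hΛB hL1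
  -- the adjoint from ★ p857605 by conjugation
  have hP := integral_wt_smul_intertwining_mul_conj_eq_three hc hc1 νG ν hβ h𝓕N h𝓕₀ h𝓕top hχm hψm hχN hψN hχB hψB habs habs'
  have hadj : ∫ g, (β g).toReal • (({y : (quasiSplit F E c 3).Adelic | borelHeight y ≤ T}.indicator (flatSectionU φ z) g - {y : (quasiSplit F E c 3).Adelic | T < borelHeight y}.indicator (flatSectionU φt (2 - z)) g) * conj (∫ u : ↥(adelicUnipotent F E c 3), {y : (quasiSplit F E c 3).Adelic | T < borelHeight y}.indicator (flatSectionU φ' z' + flatSectionU φt' (2 - z')) ((quasiSplit F E c 3).toAdelic (weylLongU (c : E →+* E) (rfl : (StdForm.antidiagonal 3).over E = (StdForm.antidiagonal 3).over E)) * ((u : (quasiSplit F E c 3).Adelic) * g)) ∂ν)) ∂νG = ∫ g, (β g).toReal • ((∫ u : ↥(adelicUnipotent F E c 3), ({y : (quasiSplit F E c 3).Adelic | borelHeight y ≤ T}.indicator (flatSectionU φ z) (((quasiSplit F E c 3).toAdelic (weylLongU (c : E →+* E) (rfl : (StdForm.antidiagonal 3).over E = (StdForm.antidiagonal 3).over E)))⁻¹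 * ((u : (quasiSplit F E c 3).Adelic) * g)) - {y : (quasiSplit F E c 3).Adelic | T < borelHeight y}.indicator (flatSectionU φt (2 - z)) (((quasiSplit F E c 3).toAdelic (weylLongU (c : E →+* E) (rfl : (StdForm.antidiagonal 3).over E = (StdForm.antidiagonal 3).over E)))⁻¹ * ((u : (quasiSplit F E c 3).Adelic) * g))) ∂ν) * conj ({y : (quasiSplit F E c 3).Adelic | T < borelHeight y}.indicator (flatSectionU φ' z' + flatSectionU φt' (2 - z')) g)) ∂νG := by
    have h1 := congrArg conj hP
    rw [← integral_conj, ← integral_conj] at h1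
    simp only [conj_weight_smul_mul_conj] at h1
    exact h1
  exact hGen hβ hT hφm hφN hφB hφC hφ'm hφ'N hφ'B hφ'C hφtm hφtN hφtB hφtC hφt'm hφt'N hφt'B hφt'C hz' hzz' hCT hsum hΛm hΛG hΛbdd hψL1
    (CT' := borelConstantTerm ν 𝓕 Λ')
    (M := fun hh g => ∫ u : ↥(adelicUnipotent F E c 3), hh ((quasiSplit F E c 3).toAdelic (weylLongU (c : E →+* E) (rfl : (StdForm.antidiagonal 3).over E = (StdForm.antidiagonal 3).over E)) * ((u : (quasiSplit F E c 3).Adelic) * g)) ∂ν)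
    (M' := fun hh g => ∫ u : ↥(adelicUnipotent F E c 3), hh (((quasiSplit F E c 3).toAdelic (weylLongU (c : E →+* E) (rfl : (StdForm.antidiagonal 3).over E = (StdForm.antidiagonal 3).over E)))⁻¹ * ((u : (quasiSplit F E c 3).Adelic) * g)) ∂ν)
    hAVG hCT' hadj hM'ψ hi₅ hΞ₁m hΞ₁C hΞ₁K hΞ₁M hΞ₁ hΞ₂m hΞ₂C hΞ₂K hΞ₂M hΞ₂ hΞ₃m hΞ₃C hΞ₃K hΞ₃M hΞ₃ hΞ₄m hΞ₄C hΞ₄K hΞ₄M hΞ₄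

end Summit.HodgeConjecture.HodgeConjecture.Cruxes.H413.K2E1MaassSelbergCMThreeAdjoint

end
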